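import Summits.RiemannHypothesis.RiemannHypothesis.Theorems.PfPersistenceDownConeNodal
import HarnessLib

/-!
# PF persistence, fake seat 5 — the ODD TAIL-CONE lemma (beyond-cutoff up-dials force odd nodes)

Unit `pub-rhpf-fake-5` of the `pub-rhpf` cell (mechanism / rigidity campaign; **no RH claims**).

Companion of the down-cone lemma `PfPersistenceDownCone.re_weilQuadratic_le_of_oneSigned`
(fake seat 4): that lemma says that LOWERING weights (`w' ≤ w_ζ`) can only RAISE `Re Q` on
ONE-SIGNED real tests, because the autocorrelation `k = f ⋆ f̃` of a one-signed `f` is `≥ 0`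
pointwise.  Here is the odd-sector counterpart, which needs no sign on the interior weights but
only acts on the TAIL `log n ≥ a` of the window `[-a, a]`:

* (POINTWISE) if `f` is real, ODD, HALF-SIGNED (`f ≥ 0` on `(0, ∞)`) and supported in `[-a, a]`,
  then `k(y) = ∫ f(u) f(u - y) du ≤ 0` for every `|y| ≥ a`
  (`re_autocorr_nonpos_of_odd_tail`): for `y ≥ a` the integrand lives on `0 ≤ u ≤ a`,
  `u - y ≤ 0`, where `f(u) ≥ 0 ≥ f(u - y)`.
* (TAIL UP-CONE MONOTONICITY) if two weight tables agree at every `n` with `log n < a` and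
  `w ≤ w'` at every `n` with `log n ≥ a` (an UP-dial, or any re-weighting upwards, of TAIL prime
  powers only), then `Re Q_w(f) ≤ Re Q_{w'}(f)` for every such `f`
  (`re_quadratic_mono_of_odd_tailUpCone`, `re_weilQuadratic_le_of_odd_tailUpCone`); in
  particular for the observatory's one-prime dial `dial p K w_ζ` with `K ≥ 1` and `log p ≥ a`
  (`re_weilQuadratic_le_tailUpDial_of_odd`).
* (ODD NODAL FORCING) consequently an odd real window test whose energy DROPS under such a
  re-weighting (`Re Q_{w'}(f) < Re Q_ζ(f)`, e.g. `Re Q_{w'}(f) < 0 ≤ Re Q_ζ(f)`) takes BOTH signs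
  on `(0, a]` (`odd_sign_change_of_re_quadratic_lt`, `odd_sign_change_on_window_of_re_quadratic_lt`;
  at a `ζ`-positive window `odd_sign_change_on_window_of_neg`, `tailUpDial_odd_sign_change_on_window`;
  under RH at every window `tailUpDial_odd_sign_change_on_window_of_riemannHypothesis`).

Why this matters for the cell (FAKES.md §5.6, GAP-CLASSES row F5-EO): every beyond-cutoff twin
`T_{p,K}` of fake seat 5 dials a prime `p > e^{2A}` and is looked at on windows `a < 2A < log p`,
so the dialled prime is ALWAYS a tail prime.  The two cone lemmas then give a THEOREM-level
sign rule per (sector, direction): (even, `K ≤ 1`) and (odd, `K ≥ 1`) ground states of a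
negative twin are NODAL wherever `ζ` is window-positive; the complementary cells
(even, `K ≥ 1`) and (odd, `K ≤ 1`) are unprotected by sign rules and are decided by DATA
(compute jobs of the seat: edge-localised oscillatory minimisers).  Nothing here is a statement
about `ζ`'s own positivity.

References: A. Weil 1952 (the quadratic functional); E. Bombieri, Rend. Mat. Acc. Lincei (9) 11
(2000), Thm 2 (the explicit formula as a quadratic form in the autocorrelation); H. Yoshida,
Adv. Stud. Pure Math. 21 (1992) §2 (even/odd splitting of the window form).
-/

set_option linter.dupNamespace false  -- the mandated namespace repeats `RiemannHypothesis`

noncomputable section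

open MeasureTheory Set Filter Complex
open scoped Real Topology ComplexConjugate ContDiff

namespace Summit.RiemannHypothesis.RiemannHypothesis.Theorems.PfPersistenceF5OddTailCone

open Literature.NumberTheory.LFunctions
open Summit.RiemannHypothesis.RiemannHypothesis.Theorems.PfPersistenceBarrier
open Summit.RiemannHypothesis.RiemannHypothesis.Theorems.PfPersistenceBarrier.ExplicitDatum
open Summit.RiemannHypothesis.RiemannHypothesis.Theorems.PfPersistenceDownCone

variable {a : ℝ}

/-! ## §1 Odd half-signed real tests -/

/-- An odd function that is `≥ 0` on `(0, ∞)` is `≥ 0` on `[0, ∞)`. [folklore] -/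
theorem odd_halfSigned_nonneg {f : ℝ → ℝ} (hodd : ∀ t, f (-t) = -f t)
    (hpos : ∀ t, 0 < t → 0 ≤ f t) {t : ℝ} (ht : 0 ≤ t) : 0 ≤ f t := by
  rcases ht.eq_or_lt with h | h
  · have h0 : f 0 = 0 := by
      have := hodd 0
      rw [neg_zero] at this
      linarith
    rw [← h, h0]
  · exact hpos t h

/-- An odd function that is `≥ 0` on `(0, ∞)` is `≤ 0` on `(-∞, 0]`. [folklore] -/
theorem odd_halfSigned_nonpos {f : ℝ → ℝ} (hodd : ∀ t, f (-t) = -f t)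
    (hpos : ∀ t, 0 < t → 0 ≤ f t) {t : ℝ} (ht : t ≤ 0) : f t ≤ 0 := by
  have h := odd_halfSigned_nonneg hodd hpos (neg_nonneg.2 ht)
  rw [hodd] at h
  linarith

/-! ## §2 The autocorrelation of an odd half-signed test is nonpositive on the tail -/

/-- **Pointwise**: `f(u) f(u - y) ≤ 0` for every `u` once `|y| ≥ a`, for `f` odd, half-signed,
supported in `[-a, a]`. [folklore] -/
theorem mul_shift_nonpos_of_odd_tail {f : ℝ → ℝ} (hodd : ∀ t, f (-t) = -f t)
    (hpos : ∀ t, 0 < t → 0 ≤ f t) (hsupp : tsupport (fun t ↦ (f t : ℂ)) ⊆ Icc (-a) a)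
    {y : ℝ} (hy : a ≤ |y|) (u : ℝ) : f u * f (u - y) ≤ 0 := by
  by_cases hu : f u = 0
  · simp [hu]
  by_cases hv : f (u - y) = 0
  · simp [hv]
  have hu' : u ∈ Icc (-a) a := by
    by_contra h
    exact hu (apply_eq_zero_of_not_mem_window hsupp h)
  have hv' : u - y ∈ Icc (-a) a := by
    by_contra h
    exact hv (apply_eq_zero_of_not_mem_window hsupp h)
  rw [mem_Icc] at hu' hv'
  rcases le_abs.1 hy with h | h
  · -- `y ≥ a`: `u ≥ y - a ≥ 0` and `u - y ≤ a - y ≤ 0`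
    have h1 : 0 ≤ f u := odd_halfSigned_nonneg hodd hpos (by linarith [hv'.1])
    have h2 : f (u - y) ≤ 0 := odd_halfSigned_nonpos hodd hpos (by linarith [hu'.2])
    exact mul_nonpos_iff.2 (Or.inl ⟨h1, h2⟩)
  · -- `y ≤ -a`: `u ≤ a + y ≤ 0` and `u - y ≥ -a - y ≥ 0`
    have h1 : f u ≤ 0 := odd_halfSigned_nonpos hodd hpos (by linarith [hv'.2])
    have h2 : 0 ≤ f (u - y) := odd_halfSigned_nonneg hodd hpos (by linarith [hu'.1])
    exact mul_nonpos_iff.2 (Or.inr ⟨h1, h2⟩)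

/-- **`k = f ⋆ f̃ ≤ 0` on the tail `|y| ≥ a`** for `f` odd, half-signed, supported in `[-a, a]`.
[folklore] -/
theorem re_autocorr_nonpos_of_odd_tail {f : ℝ → ℝ} (hodd : ∀ t, f (-t) = -f t)
    (hpos : ∀ t, 0 < t → 0 ≤ f t) (hsupp : tsupport (fun t ↦ (f t : ℂ)) ⊆ Icc (-a) a)
    {y : ℝ} (hy : a ≤ |y|) :
    (weilConv (fun t ↦ (f t : ℂ)) (weilReflect fun t ↦ (f t : ℂ)) y).re ≤ 0 := by
  rw [weilConv_weilReflect_ofReal, Complex.ofReal_re]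
  exact integral_nonpos fun u ↦ mul_shift_nonpos_of_odd_tail hodd hpos hsupp hy u

/-! ## §3 Tail up-cone monotonicity of `Re Q` on odd half-signed tests -/

/-- **Tail up-cone monotonicity** (half-signed odd tests): if `w' = w` at every `n` with
`log n < a` and `w ≤ w'` at every `n` with `log n ≥ a`, then `Re Q_w(f) ≤ Re Q_{w'}(f)` for every
odd real window test `f ≥ 0` on `(0, ∞)` supported in `[-a, a]`. [folklore] -/
theorem re_quadratic_mono_of_odd_tailUpCone_pos {w w' : ℕ → ℝ}
    (htail : ∀ n : ℕ, a ≤ Real.log n → w n ≤ w' n)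
    (hint : ∀ n : ℕ, Real.log n < a → w' n = w n) {f : ℝ → ℝ}
    (hodd : ∀ t, f (-t) = -f t) (hpos : ∀ t, 0 < t → 0 ≤ f t)
    (hg : IsWeilTest fun t ↦ (f t : ℂ)) (hsupp : tsupport (fun t ↦ (f t : ℂ)) ⊆ Icc (-a) a) :
    ((tableDatum w).quadratic fun t ↦ (f t : ℂ)).re ≤
      ((tableDatum w').quadratic fun t ↦ (f t : ℂ)).re := by
  obtain ⟨N, hN⟩ := exists_window_le_log_succ_half a
  have hsupp' : tsupport (fun t ↦ (f t : ℂ)) ⊆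
      Icc (-(Real.log ((N : ℝ) + 1) / 2)) (Real.log ((N : ℝ) + 1) / 2) :=
    hsupp.trans (Icc_subset_Icc (by linarith) hN)
  rw [tableDatum_quadratic_eq_add_sum w w' hg N hsupp', Complex.add_re, Complex.re_sum]
  have hsum : 0 ≤ ∑ n ∈ Finset.range (N + 1), (((w n - w' n : ℝ) : ℂ) *
      (weilConv (fun t ↦ (f t : ℂ)) (weilReflect fun t ↦ (f t : ℂ)) (Real.log n) +
        weilConv (fun t ↦ (f t : ℂ)) (weilReflect fun t ↦ (f t : ℂ)) (-Real.log n))).re := by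
    refine Finset.sum_nonneg fun n _ ↦ ?_
    rw [Complex.re_ofReal_mul, Complex.add_re]
    by_cases hn : a ≤ Real.log n
    · have h1 : w n - w' n ≤ 0 := sub_nonpos.2 (htail n hn)
      have h2 : (weilConv (fun t ↦ (f t : ℂ)) (weilReflect fun t ↦ (f t : ℂ)) (Real.log n)).re +
          (weilConv (fun t ↦ (f t : ℂ)) (weilReflect fun t ↦ (f t : ℂ)) (-Real.log n)).re ≤ 0 :=
        add_nonpos (re_autocorr_nonpos_of_odd_tail hodd hpos hsupp (hn.trans (le_abs_self _)))
          (re_autocorr_nonpos_of_odd_tail hodd hpos hsupp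
            (by rw [abs_neg]; exact hn.trans (le_abs_self _)))
      nlinarith [h1, h2]
    · have h0 : w n - w' n = 0 := by rw [hint n (not_le.1 hn)]; ring
      rw [h0, zero_mul]
  linarith

/-- `−f` is odd if `f` is. [folklore] -/
theorem odd_neg {f : ℝ → ℝ} (hodd : ∀ t, f (-t) = -f t) (t : ℝ) : (-f (-t)) = -(-f t) := by
  rw [hodd]

/-- **Tail up-cone monotonicity on HALF-SIGNED odd tests** (`f ≥ 0` or `f ≤ 0` on `(0, ∞)`).
[folklore] -/
theorem re_quadratic_mono_of_odd_tailUpCone {w w' : ℕ → ℝ}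
    (htail : ∀ n : ℕ, a ≤ Real.log n → w n ≤ w' n)
    (hint : ∀ n : ℕ, Real.log n < a → w' n = w n) {f : ℝ → ℝ}
    (hodd : ∀ t, f (-t) = -f t) (h1 : (∀ t, 0 < t → 0 ≤ f t) ∨ (∀ t, 0 < t → f t ≤ 0))
    (hg : IsWeilTest fun t ↦ (f t : ℂ)) (hsupp : tsupport (fun t ↦ (f t : ℂ)) ⊆ Icc (-a) a) :
    ((tableDatum w).quadratic fun t ↦ (f t : ℂ)).re ≤
      ((tableDatum w').quadratic fun t ↦ (f t : ℂ)).re := by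
  rcases h1 with hf | hf
  · exact re_quadratic_mono_of_odd_tailUpCone_pos htail hint hodd hf hg hsupp
  · have hf' : ∀ t, 0 < t → 0 ≤ -f t := fun t ht ↦ neg_nonneg.2 (hf t ht)
    have hodd' : ∀ t, (-f (-t)) = -(-f t) := odd_neg hodd
    have key := re_quadratic_mono_of_odd_tailUpCone_pos (f := fun t ↦ -f t) htail hint hodd' hf'
      (isWeilTest_neg_ofReal hg) (by rw [tsupport_neg_ofReal]; exact hsupp)
    have e : (fun t ↦ ((-f t : ℝ) : ℂ)) = fun t ↦ -((f t : ℂ)) := by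
      funext t; push_cast; rfl
    rwa [e, tableDatum_quadratic_neg, tableDatum_quadratic_neg] at key

/-- **The tail up-cone of `ζ`, odd half-signed tests**: `w' = w_ζ` below `a` and `w' ≥ w_ζ` on the
tail `log n ≥ a` `⟹ Re Q_ζ(f) ≤ Re Q_{w'}(f)` for every odd half-signed real window test `f`.
[folklore] -/
theorem re_weilQuadratic_le_of_odd_tailUpCone {w' : ℕ → ℝ}
    (htail : ∀ n : ℕ, a ≤ Real.log n → zetaTable n ≤ w' n)
    (hint : ∀ n : ℕ, Real.log n < a → w' n = zetaTable n) {f : ℝ → ℝ}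
    (hodd : ∀ t, f (-t) = -f t) (h1 : (∀ t, 0 < t → 0 ≤ f t) ∨ (∀ t, 0 < t → f t ≤ 0))
    (hg : IsWeilTest fun t ↦ (f t : ℂ)) (hsupp : tsupport (fun t ↦ (f t : ℂ)) ⊆ Icc (-a) a) :
    (weilQuadratic fun t ↦ (f t : ℂ)).re ≤ ((tableDatum w').quadratic fun t ↦ (f t : ℂ)).re := by
  rw [← tableDatum_zetaTable_quadratic]
  exact re_quadratic_mono_of_odd_tailUpCone htail hint hodd h1 hg hsupp

/-- Beyond-cutoff UP-dials (`PfPersistenceLocalityBarrier.dial p K w_ζ`, `K ≥ 1`, `log p ≥ a`)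
are TAIL UP-CONE at window `a`: `≥ w_ζ` on the tail, `= w_ζ` below `a`. [folklore] -/
theorem tailUpDial_tailUpCone {p : ℕ} {K : ℝ} (hK : 1 ≤ K) (hp : a ≤ Real.log p) :
    (∀ n : ℕ, a ≤ Real.log n → zetaTable n ≤ PfPersistence.dial p K PfPersistence.zetaWeights n) ∧
      (∀ n : ℕ, Real.log n < a → PfPersistence.dial p K PfPersistence.zetaWeights n = zetaTable n) := by
  refine ⟨fun n _ ↦ ?_, fun n hn ↦ ?_⟩
  · rw [← zetaTable_eq_zetaWeights]
    unfold PfPersistence.dial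
    split_ifs with h
    · calc zetaTable n = 1 * zetaTable n := (one_mul _).symm
        _ ≤ K * zetaTable n := mul_le_mul_of_nonneg_right hK (zetaTable_nonneg n)
    · exact le_rfl
  · rw [← zetaTable_eq_zetaWeights]
    unfold PfPersistence.dial
    split_ifs with h
    · exact absurd (h ▸ hp) (not_le.2 hn)
    · rfl

/-- **Beyond-cutoff UP-dials** (`K ≥ 1`, `log p ≥ a`): `Re Q_ζ(f) ≤ Re Q_{dial}(f)` for every odd
half-signed real window test `f` of window `a`. [folklore] -/
theorem re_weilQuadratic_le_tailUpDial_of_odd {p : ℕ} {K : ℝ} (hK : 1 ≤ K)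
    (hp : a ≤ Real.log p) {f : ℝ → ℝ}
    (hodd : ∀ t, f (-t) = -f t) (h1 : (∀ t, 0 < t → 0 ≤ f t) ∨ (∀ t, 0 < t → f t ≤ 0))
    (hg : IsWeilTest fun t ↦ (f t : ℂ)) (hsupp : tsupport (fun t ↦ (f t : ℂ)) ⊆ Icc (-a) a) :
    (weilQuadratic fun t ↦ (f t : ℂ)).re ≤
      ((tableDatum (PfPersistence.dial p K PfPersistence.zetaWeights)).quadratic
        fun t ↦ (f t : ℂ)).re :=
  re_weilQuadratic_le_of_odd_tailUpCone (tailUpDial_tailUpCone hK hp).1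
    (tailUpDial_tailUpCone hK hp).2 hodd h1 hg hsupp

/-! ## §4 Odd nodal forcing -/

/-- **Odd nodal forcing.**  Under the tail up-cone hypotheses, an ODD real window test whose
energy drops (`Re Q_{w'}(f) < Re Q_ζ(f)`) takes both signs on `(0, ∞)`. [folklore] -/
theorem odd_sign_change_of_re_quadratic_lt {w' : ℕ → ℝ}
    (htail : ∀ n : ℕ, a ≤ Real.log n → zetaTable n ≤ w' n)
    (hint : ∀ n : ℕ, Real.log n < a → w' n = zetaTable n) {f : ℝ → ℝ}
    (hodd : ∀ t, f (-t) = -f t)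
    (hg : IsWeilTest fun t ↦ (f t : ℂ)) (hsupp : tsupport (fun t ↦ (f t : ℂ)) ⊆ Icc (-a) a)
    (hlt : ((tableDatum w').quadratic fun t ↦ (f t : ℂ)).re < (weilQuadratic fun t ↦ (f t : ℂ)).re) :
    (∃ s, 0 < s ∧ f s < 0) ∧ (∃ t, 0 < t ∧ 0 < f t) := by
  by_contra h
  rw [not_and_or] at h
  have h1 : (∀ t, 0 < t → 0 ≤ f t) ∨ (∀ t, 0 < t → f t ≤ 0) := by
    rcases h with h | h
    · left
      intro t ht
      by_contra hc
      exact h ⟨t, ht, not_le.1 hc⟩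
    · right
      intro t ht
      by_contra hc
      exact h ⟨t, ht, not_le.1 hc⟩
  exact absurd (re_weilQuadratic_le_of_odd_tailUpCone htail hint hodd h1 hg hsupp) (not_le.2 hlt)

/-- **Odd nodal forcing at a window where `Re Q_ζ(f) ≥ 0`** (e.g. wherever `ζ` is window-positive):
`Re Q_{w'}(f) < 0 ⟹ f` takes both signs on `(0, ∞)`. [folklore] -/
theorem odd_sign_change_of_re_quadratic_neg {w' : ℕ → ℝ}
    (htail : ∀ n : ℕ, a ≤ Real.log n → zetaTable n ≤ w' n)
    (hint : ∀ n : ℕ, Real.log n < a → w' n = zetaTable n) {f : ℝ → ℝ}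
    (hodd : ∀ t, f (-t) = -f t)
    (hg : IsWeilTest fun t ↦ (f t : ℂ)) (hsupp : tsupport (fun t ↦ (f t : ℂ)) ⊆ Icc (-a) a)
    (hζ : 0 ≤ (weilQuadratic fun t ↦ (f t : ℂ)).re)
    (hneg : ((tableDatum w').quadratic fun t ↦ (f t : ℂ)).re < 0) :
    (∃ s, 0 < s ∧ f s < 0) ∧ (∃ t, 0 < t ∧ 0 < f t) :=
  odd_sign_change_of_re_quadratic_lt htail hint hodd hg hsupp (hneg.trans_le hζ)

/-- **Window form**: the two signs are taken INSIDE `(0, a]` (the test vanishes off `[-a, a]`).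
[folklore] -/
theorem odd_sign_change_on_window_of_re_quadratic_lt {w' : ℕ → ℝ}
    (htail : ∀ n : ℕ, a ≤ Real.log n → zetaTable n ≤ w' n)
    (hint : ∀ n : ℕ, Real.log n < a → w' n = zetaTable n) {f : ℝ → ℝ}
    (hodd : ∀ t, f (-t) = -f t)
    (hg : IsWeilTest fun t ↦ (f t : ℂ)) (hsupp : tsupport (fun t ↦ (f t : ℂ)) ⊆ Icc (-a) a)
    (hlt : ((tableDatum w').quadratic fun t ↦ (f t : ℂ)).re < (weilQuadratic fun t ↦ (f t : ℂ)).re) :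
    (∃ s ∈ Ioc 0 a, f s < 0) ∧ (∃ t ∈ Ioc 0 a, 0 < f t) := by
  obtain ⟨⟨s, hs0, hs⟩, ⟨t, ht0, ht⟩⟩ :=
    odd_sign_change_of_re_quadratic_lt htail hint hodd hg hsupp hlt
  exact ⟨⟨s, ⟨hs0, (mem_Icc.1 (mem_window_of_ne_zero hsupp hs.ne)).2⟩, hs⟩,
    ⟨t, ⟨ht0, (mem_Icc.1 (mem_window_of_ne_zero hsupp ht.ne')).2⟩, ht⟩⟩

/-- **At a `ζ`-positive window every negative ODD direction of a tail up-cone fake is nodal in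
`(0, a]`.** [folklore] -/
theorem odd_sign_change_on_window_of_neg (hpos : WeilPositivityOn a) {w' : ℕ → ℝ}
    (htail : ∀ n : ℕ, a ≤ Real.log n → zetaTable n ≤ w' n)
    (hint : ∀ n : ℕ, Real.log n < a → w' n = zetaTable n) {f : ℝ → ℝ}
    (hodd : ∀ t, f (-t) = -f t)
    (hg : IsWeilTest fun t ↦ (f t : ℂ)) (hsupp : tsupport (fun t ↦ (f t : ℂ)) ⊆ Icc (-a) a)
    (hneg : ((tableDatum w').quadratic fun t ↦ (f t : ℂ)).re < 0) :
    (∃ s ∈ Ioc 0 a, f s < 0) ∧ (∃ t ∈ Ioc 0 a, 0 < f t) :=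
  odd_sign_change_on_window_of_re_quadratic_lt htail hint hodd hg hsupp
    (hneg.trans_le (hpos _ hg hsupp))

/-- **Beyond-cutoff UP-dial form** (the `F₊` direction on a TAIL prime: `K ≥ 1`, `log p ≥ a`): at a
`ζ`-positive window, every ODD real test on which the dialled form is negative changes sign inside
`(0, a]`.  Companion of `PfPersistenceDownConeNodal.dial_sign_change_on_window` (`K ≤ 1`, all
real tests). [folklore] -/
theorem tailUpDial_odd_sign_change_on_window (hpos : WeilPositivityOn a) {p : ℕ} {K : ℝ}
    (hK : 1 ≤ K) (hp : a ≤ Real.log p) {f : ℝ → ℝ} (hodd : ∀ t, f (-t) = -f t)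
    (hg : IsWeilTest fun t ↦ (f t : ℂ)) (hsupp : tsupport (fun t ↦ (f t : ℂ)) ⊆ Icc (-a) a)
    (hneg : ((tableDatum (PfPersistence.dial p K PfPersistence.zetaWeights)).quadratic
      fun t ↦ (f t : ℂ)).re < 0) :
    (∃ s ∈ Ioc 0 a, f s < 0) ∧ (∃ t ∈ Ioc 0 a, 0 < f t) :=
  odd_sign_change_on_window_of_neg hpos (tailUpDial_tailUpCone hK hp).1
    (tailUpDial_tailUpCone hK hp).2 hodd hg hsupp hneg

/-- **Under RH, at every window** (the tree's `weil_criterion_holds`): negative odd directions of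
beyond-cutoff up-dials are nodal in `(0, a]`. [folklore] -/
theorem tailUpDial_odd_sign_change_on_window_of_riemannHypothesis (hRH : RiemannHypothesis)
    {p : ℕ} {K : ℝ} (hK : 1 ≤ K) (hp : a ≤ Real.log p) {f : ℝ → ℝ} (hodd : ∀ t, f (-t) = -f t)
    (hg : IsWeilTest fun t ↦ (f t : ℂ)) (hsupp : tsupport (fun t ↦ (f t : ℂ)) ⊆ Icc (-a) a)
    (hneg : ((tableDatum (PfPersistence.dial p K PfPersistence.zetaWeights)).quadratic
      fun t ↦ (f t : ℂ)).re < 0) :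
    (∃ s ∈ Ioc 0 a, f s < 0) ∧ (∃ t ∈ Ioc 0 a, 0 < f t) :=
  tailUpDial_odd_sign_change_on_window (fun g hg' _ ↦ weil_criterion_holds.1 hRH g hg')
    hK hp hodd hg hsupp hneg

/-! ## §5 The sign-rule pair

Together with fake seat 4's down-cone lemma this gives, for one-prime dials of a TAIL prime
(`log p ≥ a`), a THEOREM-level sign rule in two of the four (sector, direction) cells:
(either sector, `K ≤ 1`): one-signed tests cannot go below `ζ`
(`PfPersistenceDownCone.re_weilQuadratic_le_of_oneSigned`) — this protects the EVEN sector, whose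
nodeless states are one-signed; (odd sector, `K ≥ 1`): half-signed odd tests cannot
(`re_weilQuadratic_le_tailUpDial_of_odd`) — this protects the ODD sector, whose nodeless states
are half-signed.  The two remaining cells, (even, `K ≥ 1`) and (odd, `K ≤ 1`), carry NO sign rule:
there the natural negative test of `PfPersistenceF5TailTwins` — the two-bump
`g(x + A) - σ g(x - A)`, `σ = sign (1 - K)` — is itself one-signed (even, `K > 1`) resp.
half-signed odd (`K < 1`).  Whether the GROUND state is nodeless in those cells is the DATA
question of FAKES.md §5.6 (edge-localised oscillatory minimisers at small offsets). -/

end Summit.RiemannHypothesis.RiemannHypothesis.Theorems.PfPersistenceF5OddTailCone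

end
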